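import Summits.BirchSwinnertonDyer.BirchSwinnertonDyer.Theorems.ByReductionTypeAtTwoEulerCharFormalBound
import Literature.NumberTheory.GaloisRepresentations.LocalDualityTwoZero
import Literature.NumberTheory.EllipticCurves.LocalWeilPairingDuality
import Literature.NumberTheory.EllipticCurves.OrdinaryLocalKummerCountProofs
import Literature.NumberTheory.EllipticCurves.CyclotomicLineWeilPairingProofs
import HarnessLib

/-!
# Route `ByReductionTypeAtTwo` (K4), TOWER road — Lemma 3.4 at layer `0`, the local count:
# `p^e ≤ #H²(Γ_{ℚ_v}, Ê[p^e])` for `p^e = #Ẽ(𝔽_p)_p` (Tate duality + the Weil pairing on the ordinary line)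

Cell `bsd-2adic`, seat `bsd-2adic-tower-1` (GEN 25), `--supports stmt-BirchSwinnertonDyer-19271` (helper). TOOL theorem only
(no definition, no named fact, no `sorry`); closes nothing by itself; BSD is not proved by any of this. Part (g) of the
programme «Greenberg LNM 1716 Lemma 3.4 at layer `0` EXACT ⇒ Thm. 4.1 over `ℚ` ⇒ the `hEC` binder of the TOWER doors in the
kernel». With `e = ord_p #Ẽ(𝔽_p)` and `Z = Ê[p^e]` (cyclic of order `p^e` on `P_e`): the `p`-primary part of `Ẽ(𝔽_p)` has
`p^e` elements, all killed by `p^e`, and `#Ẽ[p^e](𝔽̄_p) = p^e` (`#E[p^e] = p^{2e}`, `card_torsionBy_eq_sq`, over the kernel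
`Ê[p^e]` of order `p^e`, `TateModule.card_ker_torsionBy_mul_card`), so EVERY `p^e`-torsion point of the reduction is
`𝔽_p`-rational and `Γ_{ℚ_v}` acts trivially on `E[p^e]/Ê[p^e]`; the Weil pairing (`localPoints_exists_isPrimitiveRoot_smul_eq_pow`,
`det ρ_{E,p^e} = χ`) then produces a primitive `p^e`-th root of unity `ζ` on which every `σ` acts by the same scalar as on
`P_e`, so `j P_e ↦ ζ^{ij}` (`i < p^e`) are `p^e` distinct `Γ`-equivariant maps `Z → μ_{p^e}`, and
`#H²(Γ, Z) = #Hom_Γ(Z, μ_{p^e}) ≥ p^e` (`natCard_two_eq_natCard_invariants_homRep`).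

References: [GreenbergLNM1716] §2 p. 70, §3 Lemma 3.4 (p. 89); [SilvermanAEC2009] III.8.1; [MilneADT2006] I Cor. 2.3.
-/

set_option autoImplicit false
-- the Theorems namespace of this sub repeats the summit name by design (D-0017 nested layout: Summit.<S>.<Sub>)
set_option linter.dupNamespace false

noncomputable section

open scoped Classical NNReal AddSubgroup

universe u

namespace Summit.BirchSwinnertonDyer.BirchSwinnertonDyer.Theorems.GoodOrdTower

open NumberField IsDedekindDomain Field _root_.ContinuousCohomology
  Literature.NumberTheory.EllipticCurves Literature.NumberTheory.GaloisRepresentations IsDedekindDomain.HeightOneSpectrum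
  Literature.NumberTheory.GaloisRepresentations.DiscreteGaloisModule Literature.NumberTheory.EllipticCurves.ResKernel
  Literature.NumberTheory.EllipticCurves.Rank1Residual WeierstrassCurve Rat.HeightOneSpectrum

variable {p : ℕ} [hp : Fact p.Prime] {κ : ZpExtension ℚ p}

set_option maxHeartbeats 6400000 in
/-- **`p^e ≤ #H²(Γ_{ℚ_v}, Ê[p^e])`, `e = ord_p #Ẽ(𝔽_p)`**, at the package level of `…EulerCharAssembly` (`W/ℚ` globally minimal
and elliptic with `GoodOrd W p`, `κ` cyclotomic, `v ∋ p`, `w` spectral, `red₀` the reduction of `W_ℤ ⊗ 𝒪_w`), for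
`Z = ker red₀ ∩ E(K̄_v)[p^e]` (`hZ`) and ANY continuous representation `ρ` of `Γ_{ℚ_v}` on `Z` acting as Galois (`hρ`). See
the module docstring (every `p^e`-torsion point of the reduction is rational; the Weil pairing gives `p^e` equivariant maps
`Z → μ_{p^e}`; Tate duality). [cite: GreenbergLNM1716, §3 Lemma 3.4 (p. 89); §2 p. 70] [cite: SilvermanAEC2009, Prop. III.8.1]
[cite: MilneADT2006, I Cor. 2.3] -/
theorem pow_le_natCard_H2_formalTorsion (hκ : κ.IsCyclotomic) (v : HeightOneSpectrum (𝓞 ℚ))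
    (hpv : ((p : ℕ) : 𝓞 ℚ) ∈ v.asIdeal) (W : WeierstrassCurve ℚ) [W.IsGloballyMinimal] [W.IsElliptic] (hgo : GoodOrd W p)
    {w : Valuation (AlgebraicClosure (v.adicCompletion ℚ)) ℝ≥0}
    (hw : ∀ x, (w x : ℝ) = spectralNorm (v.adicCompletion ℚ) (AlgebraicClosure (v.adicCompletion ℚ)) x)
    (red₀ : localPoints W (v.adicCompletion ℚ) →+
      (((integralModelInt W).map (algebraMap ℤ ↥w.valuationSubring)).map
        (IsLocalRing.residue ↥w.valuationSubring)).toAffine.Point)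
    (hred₀ : ∀ P : localPoints W (v.adicCompletion ℚ), red₀ P =
      ((integralModelInt W).map (algebraMap ℤ ↥w.valuationSubring)).reducePoint
        (Affine.Point.congrEquiv (localIntModel_baseChange W w.valuationSubring).symm P))
    (Z : AddSubgroup (localPoints W (v.adicCompletion ℚ)))
    (hZ : ∀ a, a ∈ Z ↔ red₀ a = 0 ∧ p ^ padicValNat p (W.reductionPointCount p) • a = 0)
    (ρ : ContinuousRep (absoluteGaloisGroup (v.adicCompletion ℚ)) ℤ Z)
    (hρ : ∀ (σ : absoluteGaloisGroup (v.adicCompletion ℚ)) (z : Z),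
      ((ρ σ z : Z) : localPoints W (v.adicCompletion ℚ)) = σ • (z : localPoints W (v.adicCompletion ℚ))) :
    Finite (continuousCohomology 2 ρ.toTopRep) ∧
      p ^ padicValNat p (W.reductionPointCount p) ≤ Nat.card (continuousCohomology 2 ρ.toTopRep) := by
  -- notation and the local data
  let K := v.adicCompletion ℚ
  let Pt : Type := localPoints W K
  let Γ := absoluteGaloisGroup K
  let Hi : Subgroup Γ := localSubgroup κ.kerSubgroup K
  set e : ℕ := padicValNat p (W.reductionPointCount p) with he
  have galois_smul_nsmul : ∀ (τ : Γ) (n : ℕ) (P : Pt), τ • (n • P) = n • (τ • P) :=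
    fun τ n P ↦ map_nsmul (DistribSMul.toAddMonoidHom Pt τ) n P
  have hord : W.HasGoodReductionAtPrime p ∧ ¬ ((p : ℕ) : ℤ) ∣ W.frobeniusTrace p := hgo
  have hΔ : ¬ ((p : ℕ) : ℤ) ∣ minimalDiscriminantInt W :=
    W.not_dvd_minimalDiscriminantInt_of_hasGoodReductionAtPrime' p hord.1
  have hvO : w.Integers w.valuationSubring := Valuation.valuationSubring.integers w
  have hΔu := W.isUnit_Δ_localIntModel hpv hw hΔ
  have hpO : w ((p : ℕ) : AlgebraicClosure K) < 1 := by
    have h := spectralValuation_algebraMap_ringOfIntegers_lt_one (v := v) hw hpv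
    rwa [map_natCast] at h
  haveI hchar : CharP (IsLocalRing.ResidueField ↥w.valuationSubring) p := by
    refine (CharP.charP_iff_prime_eq_zero hp.out).mpr ?_
    rw [← map_natCast (IsLocalRing.residue ↥w.valuationSubring), IsLocalRing.residue_eq_zero_iff,
      IsLocalRing.mem_maximalIdeal, mem_nonunits_iff, hvO.isUnit_iff_valuation_eq_one, map_natCast]
    exact ne_of_lt hpO
  haveI hV : (W.baseChange (AlgebraicClosure (v.adicCompletion ℚ))).IsIntegral w.integer :=
    ⟨⟨(integralModelInt W).map (algebraMap ℤ ↥w.integer), W.baseChange_eq_localIntModel_integer_baseChange⟩⟩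
  obtain ⟨𝔐, h𝔐⟩ := v.localPrimesAbove_nonempty
  have hϖ : Irreducible ((p : ℕ) : v.adicCompletionIntegers ℚ) := irreducible_natCast_adicCompletionIntegers_rat hpv
  obtain ⟨τ, hτ, hτfix⟩ := exists_isArithFrobAt_forall_smul_eq hw h𝔐 hpv hϖ
  have hτHi : τ ∈ Hi :=
    (mem_localSubgroup_iff _ _ τ).mpr (resGal_mem_kerSubgroup_of_forall_smul_rootOfUnity_eq hκ hτfix)
  have hordA := W.exists_zsmul_eq_zero_localRed_ne_zero hw hΔu red₀ hred₀ hpv hΔ hord.2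
  obtain ⟨hgenr, hsurj, -⟩ := W.localRed_ordinary_filtration hΔu red₀ hred₀ hordA
  have hstab : ∀ (σ : Γ) (Q : Pt), red₀ Q = 0 → red₀ (σ • Q) = 0 :=
    fun σ Q hQ ↦ (W.localRed_smul_eq_zero_iff hw hΔu red₀ hred₀ σ Q).mpr hQ
  -- `Z = Ê[p^e]` is cyclic of order `p^e` on `P_e`
  obtain ⟨Pk, hPk0, hPkord, hPkgen⟩ := hgenr e
  have hPk2 : p ^ e • Pk = 0 := by rw [← hPkord]; exact addOrderOf_nsmul_eq_zero Pk
  let Pz : Z := ⟨Pk, (hZ Pk).mpr ⟨hPk0, hPk2⟩⟩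
  have hZgen : ∀ z : Z, ∃ i : ℕ, z = i • Pz := fun z ↦ by
    obtain ⟨c, hc⟩ := hPkgen z ((hZ _).mp z.2).1 (by rw [natCast_zsmul]; exact ((hZ _).mp z.2).2)
    exact ⟨c, Subtype.ext (by rw [AddSubmonoidClass.coe_nsmul]; exact hc)⟩
  have hPzord : addOrderOf Pz = p ^ e := by rw [← AddSubgroup.addOrderOf_coe Pz]; exact hPkord
  have hZpe : ∀ z : Z, p ^ e • z = 0 := fun z ↦ Subtype.ext (by
    rw [AddSubmonoidClass.coe_nsmul, ZeroMemClass.coe_zero]; exact ((hZ z).mp z.2).2)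
  haveI hZfin : Finite Z := Nat.finite_of_card_ne_zero (by
    have h : (AddSubgroup.zmultiples Pz : AddSubgroup Z) = ⊤ := by
      rw [eq_top_iff]; intro z _
      obtain ⟨i, hi⟩ := hZgen z
      exact hi ▸ AddSubgroup.nsmul_mem _ (AddSubgroup.mem_zmultiples Pz) _
    rw [← AddSubgroup.card_top (G := Z), ← h, Nat.card_zmultiples, hPzord]; exact pow_ne_zero e hp.out.ne_zero)
  -- duality: `#H²(Γ, Z) = #Hom_Γ(Z, μ_{p^e})`
  obtain ⟨hfin2, hcard2⟩ := @natCard_two_eq_natCard_invariants_homRep K _ _ _ _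
    (charZero_of_injective_algebraMap (algebraMap ℚ K).injective) Z _ _ _ _ p e _ ρ hZpe
  refine ⟨hfin2, ?_⟩
  rw [hcard2]
  -- STEP 1: every `p^e`-torsion point of the reduction is the reduction of a rational point
  obtain ⟨hfinR, hR⟩ := finite_range_localRed_fixedPoints_and_natCard_eq (κ := κ) W hw hΔu red₀ hred₀ hpv hΔ h𝔐 hτ hτHi
  haveI := hfinR
  let R := (red₀.comp (FixedPoints.addSubgroup Hi Pt).subtype).range
  let Rp := AddCommGroup.primaryComponent R p
  have hRp : Nat.card Rp = p ^ e := by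
    change Nat.card (AddCommGroup.primaryComponent R p) = p ^ e
    rw [card_addPrimaryComponent_eq_pow, Nat.factorization_def _ hp.out, hR]
  have hRpe : ∀ r : Rp, p ^ e • (r : Rp).1 = 0 := by
    intro r
    obtain ⟨n, hn⟩ := (AddCommGroup.mem_primaryComponent).mp r.2
    have hdvdn : addOrderOf (r : Rp).1 ∣ p ^ n := addOrderOf_dvd_of_nsmul_eq_zero hn
    obtain ⟨a, -, ha⟩ := (Nat.dvd_prime_pow hp.out).mp hdvdn
    have hdvd : p ^ a ∣ W.reductionPointCount p := by
      rw [← hR, ← ha]; exact addOrderOf_dvd_natCard _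
    have hae : a ≤ e := (padicValNat_dvd_iff_le (W.reductionPointCount_pos p).ne').mp hdvd
    rw [← addOrderOf_dvd_iff_nsmul_eq_zero, ha]
    exact pow_dvd_pow p hae
  have hRpe' : ∀ r : Rp, p ^ e • (((r : Rp).1 : R) : (((integralModelInt W).map (algebraMap ℤ ↥w.valuationSubring)).map
      (IsLocalRing.residue ↥w.valuationSubring)).toAffine.Point) = 0 := fun r ↦ by
    have h := congrArg Subtype.val (hRpe r)
    simpa only [AddSubmonoidClass.coe_nsmul, ZeroMemClass.coe_zero] using h
  -- `#Ẽ[p^e] = p^e` (no `CharZero ℚ_v` in the context: the `Algebra ℚ ℚ_v` diamond)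
  have hpe0 : p ^ e ≠ 0 := pow_ne_zero e hp.out.ne_zero
  have hpeK : ((p ^ e : ℕ) : AlgebraicClosure (v.adicCompletion ℚ)) ≠ 0 := by
    intro h
    apply hpe0
    have hinj := (algebraMap ℚ (AlgebraicClosure (v.adicCompletion ℚ))).injective
    have h' : algebraMap ℚ (AlgebraicClosure (v.adicCompletion ℚ)) ((p ^ e : ℕ) : ℚ) =
        algebraMap ℚ (AlgebraicClosure (v.adicCompletion ℚ)) 0 := by rw [map_natCast, map_zero, h]
    exact_mod_cast hinj h'
  have hsurj' : ∀ y ∈ (((integralModelInt W).map (algebraMap ℤ ↥w.valuationSubring)).map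
      (IsLocalRing.residue ↥w.valuationSubring)).toAffine.Point[(p ^ e : ℕ)],
      ∃ x ∈ (localPoints W (v.adicCompletion ℚ))[(p ^ e : ℕ)], red₀ x = y := by
    intro y hy
    obtain ⟨x, hx, hxy⟩ := hsurj e y (mem_torsionBy_iff.mp hy)
    exact ⟨x, mem_torsionBy_iff.mpr hx, hxy⟩
  have hmul := TateModule.card_ker_torsionBy_mul_card red₀ (p ^ e) hsurj'
  have hA : Nat.card ((localPoints W (v.adicCompletion ℚ))[(p ^ e : ℕ)]) = p ^ e * p ^ e := by
    have h := card_torsionBy_eq_sq (E := W.baseChange (AlgebraicClosure (v.adicCompletion ℚ))) (n := p ^ e) hpeK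
    rw [sq] at h
    exact h
  have hZcard : Nat.card Z = p ^ e := by
    have htop : (AddSubgroup.zmultiples Pz : AddSubgroup Z) = ⊤ := by
      rw [eq_top_iff]; intro z _
      obtain ⟨i, hi⟩ := hZgen z
      exact hi ▸ AddSubgroup.nsmul_mem _ (AddSubgroup.mem_zmultiples Pz) _
    rw [← hPzord, ← Nat.card_zmultiples Pz, htop, AddSubgroup.card_top]
  have hkerZ : Nat.card ((red₀.ker)[(p ^ e : ℕ)]) = p ^ e := by
    refine Eq.trans (Nat.card_congr ?_) hZcard
    refine ⟨fun x ↦ ⟨((x : red₀.ker) : Pt), (hZ _).mpr ⟨(x : red₀.ker).2, ?_⟩⟩,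
      fun y ↦ ⟨⟨(y : Pt), (AddMonoidHom.mem_ker).mpr ((hZ _).mp y.2).1⟩, ?_⟩, fun x ↦ rfl, fun y ↦ rfl⟩
    · have h := mem_torsionBy_iff.mp x.2
      rw [natCast_zsmul] at h
      have h' := congrArg Subtype.val h
      simpa only [AddSubmonoidClass.coe_nsmul, ZeroMemClass.coe_zero] using h'
    · rw [mem_torsionBy_iff, natCast_zsmul]
      apply Subtype.ext
      rw [AddSubmonoidClass.coe_nsmul, ZeroMemClass.coe_zero]
      exact ((hZ _).mp y.2).2
  rw [hkerZ, hA] at hmul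
  have hBcard : Nat.card ((((integralModelInt W).map (algebraMap ℤ ↥w.valuationSubring)).map
      (IsLocalRing.residue ↥w.valuationSubring)).toAffine.Point[(p ^ e : ℕ)]) = p ^ e :=
    Nat.eq_of_mul_eq_mul_left (Nat.pos_of_ne_zero hpe0) hmul
  -- `Rp ↪ Ẽ[p^e]` is onto (both have `p^e` elements)
  haveI : Finite ((((integralModelInt W).map (algebraMap ℤ ↥w.valuationSubring)).map
      (IsLocalRing.residue ↥w.valuationSubring)).toAffine.Point[(p ^ e : ℕ)]) :=
    Nat.finite_of_card_ne_zero (by rw [hBcard]; exact hpe0)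
  let ι : Rp → (((integralModelInt W).map (algebraMap ℤ ↥w.valuationSubring)).map
      (IsLocalRing.residue ↥w.valuationSubring)).toAffine.Point[(p ^ e : ℕ)] :=
    fun r ↦ ⟨(((r : Rp).1 : R) : _), mem_torsionBy_iff.mpr (by rw [natCast_zsmul]; exact hRpe' r)⟩
  have hι : Function.Bijective ι := by
    refine Function.Injective.bijective_of_nat_card_le (fun a b h ↦ ?_) (by rw [hBcard, hRp])
    have h' := congrArg Subtype.val h
    exact Subtype.ext (Subtype.ext h')
  have hrat : ∀ Q : Pt, p ^ e • Q = 0 → ∃ P₀ : Pt, (∀ σ : Γ, σ • P₀ = P₀) ∧ red₀ P₀ = red₀ Q := by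
    intro Q hQ
    obtain ⟨r, hr⟩ := hι.2 ⟨red₀ Q, mem_torsionBy_iff.mpr (by rw [natCast_zsmul, ← map_nsmul, hQ, map_zero])⟩
    have hr' : ((((r : Rp).1 : R)) : _) = red₀ Q := congrArg Subtype.val hr
    obtain ⟨x, hx⟩ := ((r : Rp).1 : R).2
    have hτx : τ • (x : Pt) = x := (FixedPoints.mem_addSubgroup _ _ _).mp x.2 ⟨τ, hτHi⟩
    obtain ⟨P₀, hP₀fix, hP₀⟩ := exists_fixed_localRed_eq W hw hΔu red₀ hred₀ hpv hΔ h𝔐 hτ (x : Pt) (by rw [hτx])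
    refine ⟨P₀, hP₀fix, ?_⟩
    rw [hP₀, ← hr', ← hx]; rfl
  have hredσ : ∀ (σ : Γ) (Q : Pt), p ^ e • Q = 0 → red₀ (σ • Q) = red₀ Q := by
    intro σ Q hQ
    obtain ⟨P₀, hP₀fix, hP₀⟩ := hrat Q hQ
    have h1 : red₀ (σ • (Q - P₀)) = 0 := hstab σ _ (by rw [map_sub, hP₀, sub_self])
    rw [smul_sub, map_sub, hP₀fix, sub_eq_zero] at h1
    rw [h1, hP₀]
  -- STEP 2: the cyclotomic line — `σ P_e = c(σ) P_e` and `σ ζ = ζ^{c(σ)}`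
  have hc : ∀ σ : Γ, ∃ c : ℕ, σ • Pk = c • Pk := fun σ ↦
    hPkgen _ (hstab σ Pk hPk0) (by rw [natCast_zsmul, ← galois_smul_nsmul, hPk2, smul_zero])
  choose c hcσ using hc
  obtain ⟨ζ, hζ, hζσ⟩ := @WeierstrassCurve.localPoints_exists_isPrimitiveRoot_smul_eq_pow ℚ _ W _ K _ _
    (charZero_of_injective_algebraMap (algebraMap ℚ K).injective) p _ e Pk hPkord Set.univ c (fun _ ↦ 1)
    (fun σ _ ↦ hcσ σ) (fun σ _ Q hQ ↦ by
      rw [natCast_zsmul] at hQ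
      obtain ⟨d, hd⟩ := hPkgen (σ • Q - Q) (by rw [map_sub, hredσ σ Q hQ, sub_self])
        (by rw [natCast_zsmul, smul_sub, ← galois_smul_nsmul, hQ, smul_zero, sub_self])
      exact ⟨d, by rw [one_smul]; exact hd⟩)
  -- STEP 3: the equivariant maps `j P_e ↦ ζ^{ij}`
  haveI : NeZero (p ^ e) := ⟨hpe0⟩
  let μ₀ : MuCarrier K (p ^ e) := MuCarrier.toAdditive.symm (Additive.ofMul hζ.toRootsOfUnity)
  have hμ₀ : MuCarrier.toAdditive μ₀ = Additive.ofMul hζ.toRootsOfUnity := rfl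
  have hμ₀ord : addOrderOf μ₀ = p ^ e := by
    rw [← (MuCarrier.toAdditive (K := K) (n := p ^ e)).addOrderOf_eq μ₀, hμ₀, addOrderOf_ofMul_eq_orderOf,
      ← Subgroup.orderOf_coe, ← orderOf_units, hζ.val_toRootsOfUnity_coe]
    exact hζ.eq_orderOf.symm
  have hμ₀pe : p ^ e • μ₀ = 0 := by
    have h := addOrderOf_nsmul_eq_zero μ₀
    rw [hμ₀ord] at h
    exact h
  have hωμ₀ : ∀ σ : Γ, mu K (p ^ e) σ μ₀ = c σ • μ₀ := by
    intro σ
    apply MuCarrier.toAdditive.injective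
    rw [mu_apply_apply, map_nsmul, hμ₀, ← ofMul_pow]
    refine congrArg Additive.ofMul (Subtype.ext (Units.ext ?_))
    rw [absoluteGaloisGroup.coe_smul_rootsOfUnity, Units.coe_smul, toMul_ofMul, Subgroup.coe_pow,
      Units.val_pow_eq_pow_val, hζ.val_toRootsOfUnity_coe, hζσ σ (Set.mem_univ σ), one_mul]
  have hper : ∀ i j : ℕ, i • Pz = j • Pz → i • μ₀ = j • μ₀ := by
    intro i j hij
    rw [nsmul_eq_nsmul_iff_modEq, hPzord] at hij
    rw [nsmul_eq_nsmul_iff_modEq, hμ₀ord]; exact hij  -- orders agree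
  choose idx hidx using hZgen
  let f : HomCarrier Z (MuCarrier K (p ^ e)) :=
    { toFun := fun z ↦ idx z • μ₀
      map_zero' := by
        have h := hper (idx 0) 0 (by rw [← hidx 0, zero_nsmul])
        rw [h, zero_nsmul]
      map_add' := fun z z' ↦ by
        have h := hper (idx (z + z')) (idx z + idx z') (by rw [← hidx (z + z'), add_nsmul, ← hidx z, ← hidx z'])
        rw [h, add_nsmul] }
  have hf : ∀ n : ℕ, f (n • Pz) = n • μ₀ := fun n ↦ hper _ _ (by rw [← hidx (n • Pz)])
  have hρPz : ∀ σ : Γ, ρ σ Pz = c σ • Pz := fun σ ↦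
    Subtype.ext (by rw [hρ, AddSubmonoidClass.coe_nsmul]; exact hcσ σ)
  have hfinv : f ∈ (ρ.homRep (mu K (p ^ e))).toTopRep.ρ.invariants := fun σ ↦
    (ContinuousRep.homRep_apply_eq_self_iff ρ (mu K (p ^ e)) σ f).mpr fun m ↦ by
      obtain ⟨j, rfl⟩ : ∃ j : ℕ, m = j • Pz := ⟨idx m, hidx m⟩
      rw [map_nsmul (ρ σ), hρPz, ← mul_nsmul', hf, hf, map_nsmul, hωμ₀, ← mul_nsmul', mul_comm]
  -- `p^e` distinct invariants `i • f`, `i < p^e`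
  let F : Set.Iio (p ^ e) → (ρ.homRep (mu K (p ^ e))).toTopRep.ρ.invariants := fun i ↦
    ⟨(i : ℕ) • f, nsmul_mem hfinv _⟩
  have hF : Function.Injective F := by
    intro a b hab
    have h1 : ((a : ℕ) • f) Pz = ((b : ℕ) • f) Pz := by
      have h := congrArg (fun x : (ρ.homRep (mu K (p ^ e))).toTopRep.ρ.invariants ↦ (x.1 : HomCarrier Z _) Pz) hab
      exact h
    have hfPz : f Pz = μ₀ := by
      have h := hf 1
      rwa [one_nsmul, one_nsmul] at h
    have hnf : ∀ n : ℕ, (n • f : HomCarrier Z (MuCarrier K (p ^ e))) Pz = n • μ₀ := fun n ↦ by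
      induction n with
      | zero => rw [zero_nsmul, zero_nsmul]; rfl
      | succ n ih =>
        rw [succ_nsmul, succ_nsmul, ← ih, ← hfPz]; rfl
    have h2 : (a : ℕ) • μ₀ = (b : ℕ) • μ₀ := by rw [← hnf, ← hnf]; exact h1
    have ha : (a : ℕ) ∈ Set.Iio (addOrderOf μ₀) := by rw [hμ₀ord]; exact a.2
    have hb : (b : ℕ) ∈ Set.Iio (addOrderOf μ₀) := by rw [hμ₀ord]; exact b.2
    exact Subtype.ext (nsmul_injOn_Iio_addOrderOf ha hb h2)
  haveI : Finite (MuCarrier K (p ^ e)) :=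
    @finite_muCarrier (p ^ e) _ K _ (charZero_of_injective_algebraMap (algebraMap ℚ K).injective)
  haveI : Finite (HomCarrier Z (MuCarrier K (p ^ e))) :=
    Finite.of_injective (fun g : HomCarrier Z (MuCarrier K (p ^ e)) ↦ (g : Z → MuCarrier K (p ^ e))) DFunLike.coe_injective
  haveI : Finite (ρ.homRep (mu K (p ^ e))).toTopRep.ρ.invariants := Subtype.finite
  calc p ^ e = Nat.card (Set.Iio (p ^ e)) := by rw [Nat.card_eq_fintype_card, Fintype.card_ofFinset, Nat.card_Iio]
    _ ≤ Nat.card (ρ.homRep (mu K (p ^ e))).toTopRep.ρ.invariants := Nat.card_le_card_of_injective F hF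

end Summit.BirchSwinnertonDyer.BirchSwinnertonDyer.Theorems.GoodOrdTower

end
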